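import Summits.QuantumFields.QCD.Theorems.GaussianLinkFramesFrameAPrioriBoundLineDefs
import Summits.QuantumFields.QCD.Theorems.GaussianLinkFramesFrameAPrioriBoundStubTiltTransfer
import Summits.QuantumFields.QCD.Theorems.PauliWegnerSeaPhaseQuenchedFlavourDecayPiResample

/-!
# Crux `FrameAPrioriBound` (stmt-QuantumFields-17374), line `cube-cofactor` —
# stub `stub_conditioning`

FUBINI / CONDITIONING for the product tilted-Haar law.  Write `π := Haar^{⊗E}` (all links of the
torus), `wt U := exp Σ_e Re tr(U_e J_e†)` (the full tilt weight), `tS := tiltWt S J`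
(`= exp Σ_{e ∈ S} Re tr(W_e J_e†)`) and `tSᶜ := tiltWt Sᶜ J`.  If every fibre average of a
measurable `F ≥ 0` is bounded, `∫ F(refit S U W) tS(W) dπ(W) / ∫ tS dπ ≤ M` for every exterior
`U`, then so is the full tilted average: `∫ F wt dπ / ∫ wt dπ ≤ M`.

Proof.  (i) `wt (refit S U W) = tS W · tSᶜ U` (split the exponent over `e ∈ S` / `e ∉ S`).
(ii) `Z_S := ∫ tS dπ > 0`, `Z_Sᶜ > 0` (continuous positive weights on a compact probability
space).  (iii) The resampling identity `∫⁻ Φ dπ = ∫⁻_U ∫⁻_W Φ(refit S U W) dπ dπ`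
(`CrossingSplitIntegrability.stub_piResample`) for `Φ := ofReal ∘ wt` gives `∫ wt dπ = Z_S · Z_Sᶜ`,
and for `Φ := ofReal ∘ (F · wt)` gives `∫⁻ ofReal (F wt) = ∫⁻_U I(U) · ofReal (tSᶜ U)` with the
fibre lintegral `I(U) := ∫⁻_W ofReal (F (refit S U W) tS W)`.  (iv) `M ≥ 0` (the fibre ratio at
any `U` is `≥ 0`).  If `F · wt` is not integrable the Bochner numerator is `0 ≤ M ∫ wt`.  Otherwise
the total
lintegral is finite, so `I(U) < ∞` for a.e. `U`; there the fibre integrand is integrable,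
`I(U) = ofReal (∫ F(refit) tS) ≤ ofReal (M Z_S)` by the hypothesis, whence
`∫⁻ ofReal (F wt) ≤ ofReal (M Z_S) · ofReal Z_Sᶜ = ofReal (M ∫ wt)`; divide.
-/

noncomputable section

namespace Summit.QuantumFields.QCD.Cruxes.FrameAPrioriBound.CubeCofactor

open scoped BigOperators Matrix ENNReal
open MeasureTheory Filter Set Literature.MathematicalPhysics.QuantumFieldTheory
  Literature.MathematicalPhysics.QuantumLattice Literature.Probability.LatticeModels
open Summit.QuantumFields.QCD.Theorems

namespace Conditioning

variable {L : ℕ} [NeZero L]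

/-! ### The weights: factorisation at a refit, positivity, integrability -/

/-- The full tilt weight `exp Σ_e Re tr(U_e J_e†)` is the partial tilt weight of the full link
set. -/
theorem exp_sum_eq_tiltWt (J : Edge 4 L → Matrix (Fin 3) (Fin 3) ℂ) (U : GaugeConfig 4 L SU3) :
    Real.exp (∑ e : Edge 4 L, (((U e : SU3) : Matrix (Fin 3) (Fin 3) ℂ) * (J e)ᴴ).trace.re) =
      tiltWt (fun _ => true) J U := by
  simp [tiltWt]

/-- The exponent of the full weight at a refit splits into the `S`-part, read from `W`, and the
complementary part, read from `U`. -/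
theorem sum_refit (S : Edge 4 L → Bool) (J : Edge 4 L → Matrix (Fin 3) (Fin 3) ℂ)
    (U W : GaugeConfig 4 L SU3) :
    ∑ e : Edge 4 L, (((refit S U W e : SU3) : Matrix (Fin 3) (Fin 3) ℂ) * (J e)ᴴ).trace.re =
      (∑ e : Edge 4 L,
        if S e then (((W e : SU3) : Matrix (Fin 3) (Fin 3) ℂ) * (J e)ᴴ).trace.re else 0) +
      ∑ e : Edge 4 L,
        if (!S e) then (((U e : SU3) : Matrix (Fin 3) (Fin 3) ℂ) * (J e)ᴴ).trace.re else 0 := by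
  rw [← Finset.sum_add_distrib]
  refine Finset.sum_congr rfl fun e _ => ?_
  dsimp only [refit]
  cases S e <;> simp

/-- Factorisation of the full weight at a refit:
`wt (refit S U W) = tiltWt S J W · tiltWt Sᶜ J U`. -/
theorem tiltWt_true_refit (S : Edge 4 L → Bool) (J : Edge 4 L → Matrix (Fin 3) (Fin 3) ℂ)
    (U W : GaugeConfig 4 L SU3) :
    tiltWt (fun _ => true) J (refit S U W) = tiltWt S J W * tiltWt (fun e => !S e) J U := by
  rw [← exp_sum_eq_tiltWt, sum_refit, Real.exp_add]

/-- The partial tilt weight is positive. -/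
theorem tiltWt_pos (S : Edge 4 L → Bool) (J : Edge 4 L → Matrix (Fin 3) (Fin 3) ℂ)
    (W : GaugeConfig 4 L SU3) : 0 < tiltWt S J W :=
  Real.exp_pos _

/-- Product Haar on all links is a probability measure. -/
theorem isProbabilityMeasure_haarPi : IsProbabilityMeasure (haarPi L) := by
  dsimp only [haarPi]
  infer_instance

/-- The partial tilt weight is integrable (continuous on a compact probability space). -/
theorem integrable_tiltWt (S : Edge 4 L → Bool) (J : Edge 4 L → Matrix (Fin 3) (Fin 3) ℂ) :
    Integrable (tiltWt S J) (haarPi L) := by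
  haveI := isProbabilityMeasure_haarPi (L := L)
  exact TiltedFlatnessNegative.integrable_of_continuous (TiltTransfer.continuous_tiltWt S J)

/-- The partial tilt weight has positive mass. -/
theorem integral_tiltWt_pos (S : Edge 4 L → Bool) (J : Edge 4 L → Matrix (Fin 3) (Fin 3) ℂ) :
    0 < ∫ W, tiltWt S J W ∂(haarPi L) := by
  haveI := isProbabilityMeasure_haarPi (L := L)
  obtain ⟨Wm, -, hWm⟩ := isCompact_univ.exists_isMinOn univ_nonempty
    (TiltTransfer.continuous_tiltWt S J).continuousOn
  have hle : ∫ _W, tiltWt S J Wm ∂(haarPi L) ≤ ∫ W, tiltWt S J W ∂(haarPi L) :=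
    integral_mono (integrable_const _) (integrable_tiltWt S J) fun W => hWm (mem_univ W)
  have hc : ∫ _W, tiltWt S J Wm ∂(haarPi L) = tiltWt S J Wm := by simp
  linarith [tiltWt_pos S J Wm]

/-- The lintegral of the partial tilt weight is `ofReal` of its (positive, finite) integral. -/
theorem lintegral_tiltWt (S : Edge 4 L → Bool) (J : Edge 4 L → Matrix (Fin 3) (Fin 3) ℂ) :
    ∫⁻ W, ENNReal.ofReal (tiltWt S J W) ∂(haarPi L) =
      ENNReal.ofReal (∫ W, tiltWt S J W ∂(haarPi L)) :=
  (ofReal_integral_eq_lintegral_ofReal (integrable_tiltWt S J)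
    (ae_of_all _ fun W => (tiltWt_pos S J W).le)).symm

/-! ### Measurability of the refit -/

omit [NeZero L] in
/-- The refit `(U, W) ↦ refit S U W` is jointly measurable (each coordinate is a coordinate
projection of one of the two factors). -/
theorem measurable_refit (S : Edge 4 L → Bool) :
    Measurable fun p : GaugeConfig 4 L SU3 × GaugeConfig 4 L SU3 => refit S p.1 p.2 := by
  refine measurable_pi_lambda _ fun e => ?_
  by_cases he : S e = true
  · simp only [refit, he, ↓reduceIte]
    exact (measurable_pi_apply e).comp measurable_snd
  · simp only [refit, he, Bool.false_eq_true, ↓reduceIte]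
    exact (measurable_pi_apply e).comp measurable_fst

/-- The fibre integrand `(U, W) ↦ ofReal (F (refit S U W) · tiltWt S J W)` is jointly
measurable. -/
theorem measurable_fibreIntegrand (S : Edge 4 L → Bool)
    (J : Edge 4 L → Matrix (Fin 3) (Fin 3) ℂ)
    {F : GaugeConfig 4 L SU3 → ℝ} (hF : Measurable F) :
    Measurable fun p : GaugeConfig 4 L SU3 × GaugeConfig 4 L SU3 =>
      ENNReal.ofReal (F (refit S p.1 p.2) * tiltWt S J p.2) :=
  ((hF.comp (measurable_refit S)).mul
    ((TiltTransfer.continuous_tiltWt S J).measurable.comp measurable_snd)).ennreal_ofReal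

/-! ### The conditioning bound for a general link set -/

/-- The conditioning bound, stated with the full weight written as `tiltWt (fun _ => true) J`. -/
theorem conditioning (S : Edge 4 L → Bool) (J : Edge 4 L → Matrix (Fin 3) (Fin 3) ℂ)
    {F : GaugeConfig 4 L SU3 → ℝ} (hFm : Measurable F) (hF0 : ∀ U, 0 ≤ F U) {M : ℝ}
    (hyp : ∀ U : GaugeConfig 4 L SU3,
      (∫ W, F (refit S U W) * tiltWt S J W ∂(haarPi L)) / (∫ W, tiltWt S J W ∂(haarPi L)) ≤
        M) :
    (∫ U, F U * tiltWt (fun _ => true) J U ∂(haarPi L)) /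
      (∫ U, tiltWt (fun _ => true) J U ∂(haarPi L)) ≤ M := by
  haveI := isProbabilityMeasure_haarPi (L := L)
  -- measurability of the three weights
  have hSm : Measurable fun W : GaugeConfig 4 L SU3 => ENNReal.ofReal (tiltWt S J W) :=
    (TiltTransfer.continuous_tiltWt S J).measurable.ennreal_ofReal
  have hScm : Measurable fun U : GaugeConfig 4 L SU3 =>
      ENNReal.ofReal (tiltWt (fun e => !S e) J U) :=
    (TiltTransfer.continuous_tiltWt _ J).measurable.ennreal_ofReal
  have hwtm : Measurable fun U : GaugeConfig 4 L SU3 =>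
      ENNReal.ofReal (tiltWt (fun _ => true) J U) :=
    (TiltTransfer.continuous_tiltWt _ J).measurable.ennreal_ofReal
  -- (ii) positivity of the partial and total masses
  have hZS : 0 < ∫ W, tiltWt S J W ∂(haarPi L) := integral_tiltWt_pos S J
  have hDpos : 0 < ∫ U, tiltWt (fun _ => true) J U ∂(haarPi L) := integral_tiltWt_pos _ J
  -- (iv) `M ≥ 0`: the fibre ratio at the trivial exterior is non-negative
  have hM0 : 0 ≤ M := by
    refine le_trans ?_ (hyp fun _ => 1)
    exact div_nonneg (integral_nonneg fun W => mul_nonneg (hF0 _) (tiltWt_pos S J W).le) hZS.le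
  -- (iii) the total mass factorises: `ofReal (∫ wt) = ofReal Z_S * ofReal Z_Sᶜ`
  have hD : ENNReal.ofReal (∫ U, tiltWt (fun _ => true) J U ∂(haarPi L)) =
      ENNReal.ofReal (∫ W, tiltWt S J W ∂(haarPi L)) *
        ENNReal.ofReal (∫ U, tiltWt (fun e => !S e) J U ∂(haarPi L)) := by
    have hres : ∫⁻ U, ENNReal.ofReal (tiltWt (fun _ => true) J U) ∂(haarPi L) =
        ∫⁻ U, ∫⁻ W, ENNReal.ofReal (tiltWt (fun _ => true) J (refit S U W)) ∂(haarPi L)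
          ∂(haarPi L) :=
      PhaseQuenchedFlavourDecay.CrossingSplitIntegrability.stub_piResample (Edge 4 L) SU3
        (haarProbability SU3) (fun e => S e = true) _ hwtm
    rw [← lintegral_tiltWt (fun _ => true) J, hres, ← lintegral_tiltWt S J,
      ← lintegral_tiltWt (fun e => !S e) J, ← lintegral_const_mul _ hScm]
    refine lintegral_congr fun U => ?_
    rw [← lintegral_mul_const _ hSm]
    refine lintegral_congr fun W => ?_
    rw [tiltWt_true_refit, ENNReal.ofReal_mul (tiltWt_pos S J W).le]
  -- reduce to `numerator ≤ M · denominator`; the non-integrable case is `0 ≤ M · denominator`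
  rw [div_le_iff₀ hDpos]
  by_cases hint : Integrable (fun U => F U * tiltWt (fun _ => true) J U) (haarPi L)
  swap
  · rw [integral_undef hint]
    exact mul_nonneg hM0 hDpos.le
  -- the integrable case, in `ℝ≥0∞`
  have hnn : ∀ U, 0 ≤ F U * tiltWt (fun _ => true) J U := fun U =>
    mul_nonneg (hF0 U) (tiltWt_pos _ J U).le
  rw [← ENNReal.ofReal_le_ofReal_iff (mul_nonneg hM0 hDpos.le), ENNReal.ofReal_mul hM0, hD,
    ofReal_integral_eq_lintegral_ofReal hint (ae_of_all _ hnn)]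
  -- (iii) resample the numerator
  have hΦm : Measurable fun U : GaugeConfig 4 L SU3 =>
      ENNReal.ofReal (F U * tiltWt (fun _ => true) J U) :=
    (hFm.mul (TiltTransfer.continuous_tiltWt _ J).measurable).ennreal_ofReal
  have hres : ∫⁻ U, ENNReal.ofReal (F U * tiltWt (fun _ => true) J U) ∂(haarPi L) =
      ∫⁻ U, ∫⁻ W, ENNReal.ofReal (F (refit S U W) * tiltWt (fun _ => true) J (refit S U W))
        ∂(haarPi L) ∂(haarPi L) :=
    PhaseQuenchedFlavourDecay.CrossingSplitIntegrability.stub_piResample (Edge 4 L) SU3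
      (haarProbability SU3) (fun e => S e = true) _ hΦm
  -- the fibre lintegral `I U := ∫⁻_W ofReal (F (refit S U W) · tS W)` appears on factorising
  have hfm : ∀ U : GaugeConfig 4 L SU3,
      Measurable fun W : GaugeConfig 4 L SU3 => F (refit S U W) * tiltWt S J W := fun U =>
    (hFm.comp ((measurable_refit S).comp measurable_prodMk_left)).mul
      (TiltTransfer.continuous_tiltWt S J).measurable
  have hinner : ∀ U : GaugeConfig 4 L SU3,
      ∫⁻ W, ENNReal.ofReal (F (refit S U W) * tiltWt (fun _ => true) J (refit S U W))
          ∂(haarPi L) =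
        (∫⁻ W, ENNReal.ofReal (F (refit S U W) * tiltWt S J W) ∂(haarPi L)) *
          ENNReal.ofReal (tiltWt (fun e => !S e) J U) := by
    intro U
    rw [← lintegral_mul_const _ (hfm U).ennreal_ofReal]
    refine lintegral_congr fun W => ?_
    rw [tiltWt_true_refit, ← mul_assoc,
      ENNReal.ofReal_mul (mul_nonneg (hF0 _) (tiltWt_pos S J W).le)]
  simp_rw [hinner] at hres
  rw [hres]
  -- finiteness of the total lintegral gives `I U < ∞` for a.e. `U`
  have hIm : Measurable fun U : GaugeConfig 4 L SU3 =>
      ∫⁻ W, ENNReal.ofReal (F (refit S U W) * tiltWt S J W) ∂(haarPi L) :=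
    (measurable_fibreIntegrand S J hFm).lintegral_prod_right'
  have hfin : ∫⁻ U, (∫⁻ W, ENNReal.ofReal (F (refit S U W) * tiltWt S J W) ∂(haarPi L)) *
      ENNReal.ofReal (tiltWt (fun e => !S e) J U) ∂(haarPi L) ≠ ∞ := by
    rw [← hres, ← ofReal_integral_eq_lintegral_ofReal hint (ae_of_all _ hnn)]
    exact ENNReal.ofReal_ne_top
  have hae := ae_lt_top (hIm.mul hScm) hfin
  -- the fibre bound `I U ≤ ofReal (M Z_S)`, for a.e. exterior `U`
  have hbound : ∀ᵐ U ∂(haarPi L),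
      (∫⁻ W, ENNReal.ofReal (F (refit S U W) * tiltWt S J W) ∂(haarPi L)) *
          ENNReal.ofReal (tiltWt (fun e => !S e) J U) ≤
        ENNReal.ofReal M * ENNReal.ofReal (∫ W, tiltWt S J W ∂(haarPi L)) *
          ENNReal.ofReal (tiltWt (fun e => !S e) J U) := by
    refine hae.mono fun U hU => ?_
    have hU' : (∫⁻ W, ENNReal.ofReal (F (refit S U W) * tiltWt S J W) ∂(haarPi L)) *
        ENNReal.ofReal (tiltWt (fun e => !S e) J U) < ∞ := hU
    have hIlt : ∫⁻ W, ENNReal.ofReal (F (refit S U W) * tiltWt S J W) ∂(haarPi L) < ∞ := by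
      rcases ENNReal.mul_lt_top_iff.1 hU' with h | h | h
      · exact h.1
      · rw [h]; exact ENNReal.zero_lt_top
      · exact absurd h (ENNReal.ofReal_pos.2 (tiltWt_pos _ J U)).ne'
    have hnnU : ∀ W, 0 ≤ F (refit S U W) * tiltWt S J W := fun W =>
      mul_nonneg (hF0 _) (tiltWt_pos S J W).le
    have hfi : Integrable (fun W => F (refit S U W) * tiltWt S J W) (haarPi L) :=
      (lintegral_ofReal_ne_top_iff_integrable (hfm U).aestronglyMeasurable
        (ae_of_all _ hnnU)).1 hIlt.ne
    have hb : ∫ W, F (refit S U W) * tiltWt S J W ∂(haarPi L) ≤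
        M * ∫ W, tiltWt S J W ∂(haarPi L) := (div_le_iff₀ hZS).1 (hyp U)
    refine mul_le_mul' ?_ le_rfl
    rw [← ofReal_integral_eq_lintegral_ofReal hfi (ae_of_all _ hnnU), ← ENNReal.ofReal_mul hM0]
    exact ENNReal.ofReal_le_ofReal hb
  calc ∫⁻ U, (∫⁻ W, ENNReal.ofReal (F (refit S U W) * tiltWt S J W) ∂(haarPi L)) *
        ENNReal.ofReal (tiltWt (fun e => !S e) J U) ∂(haarPi L)
      ≤ ∫⁻ U, ENNReal.ofReal M * ENNReal.ofReal (∫ W, tiltWt S J W ∂(haarPi L)) *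
          ENNReal.ofReal (tiltWt (fun e => !S e) J U) ∂(haarPi L) := lintegral_mono_ae hbound
    _ = ENNReal.ofReal M * ENNReal.ofReal (∫ W, tiltWt S J W ∂(haarPi L)) *
          ENNReal.ofReal (∫ U, tiltWt (fun e => !S e) J U ∂(haarPi L)) := by
        rw [lintegral_const_mul _ hScm, lintegral_tiltWt]
    _ = ENNReal.ofReal M * (ENNReal.ofReal (∫ W, tiltWt S J W ∂(haarPi L)) *
          ENNReal.ofReal (∫ U, tiltWt (fun e => !S e) J U ∂(haarPi L))) := mul_assoc _ _ _

end Conditioning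

open Conditioning in
/-- STUB `conditioning` (Fubini for the product law).  Under the product tilted-Haar law
`⊗_e e^{Re tr(U_e J_e†)} dU_e` on all links of the torus: if every conditional (fibre) average of
a non-negative measurable `F` — links in `S` re-sampled under the partial tilt `tiltWt S J`,
uniformly in the exterior configuration — is `≤ M`, then so is its total tilted average. -/
theorem stub_conditioning : ∀ (L : ℕ) [NeZero L] (S : Edge 4 L → Bool)
    (J : Edge 4 L → Matrix (Fin 3) (Fin 3) ℂ) (F : GaugeConfig 4 L SU3 → ℝ), Measurable F →
    (∀ U, 0 ≤ F U) → ∀ M : ℝ,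
    (∀ U : GaugeConfig 4 L SU3,
      (∫ W, F (refit S U W) * tiltWt S J W ∂(haarPi L)) / (∫ W, tiltWt S J W ∂(haarPi L)) ≤ M) →
    (∫ U, F U * Real.exp (∑ e : Edge 4 L, (((U e : SU3) : Matrix (Fin 3) (Fin 3) ℂ) * (J e)ᴴ).trace.re)
        ∂(Measure.pi fun _ : Edge 4 L => haarProbability SU3)) /
      (∫ U, Real.exp (∑ e : Edge 4 L, (((U e : SU3) : Matrix (Fin 3) (Fin 3) ℂ) * (J e)ᴴ).trace.re)
        ∂(Measure.pi fun _ : Edge 4 L => haarProbability SU3)) ≤ M := by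
  intro L _ S J F hFm hF0 M hyp
  have key := conditioning S J hFm hF0 hyp
  simp only [exp_sum_eq_tiltWt]
  exact key

end Summit.QuantumFields.QCD.Cruxes.FrameAPrioriBound.CubeCofactor

end
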